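import Literature.AlgebraicGeometry.Resolution.StrictTransformTransverseCurve
import Literature.AlgebraicGeometry.Resolution.StrictTransformGenericPoint
import HarnessLib

/-!
# Strict transforms of transverse subschemes stay transverse
# (CoP1, proof of Prop. 4.4, p. 10, structure (**) along the algorithm; Stacks 0BI7 (3), «length 1 ↦ 0»)

Topic: `Literature/AlgebraicGeometry/Resolution`. [CoP1] = Cossart–Piltant, J. Algebra 320 (2008) 1051–1082,
proof of Prop. 4.4, p. 10: the algorithm keeps the one-dimensional part of the singular locus a union of
regular curves MEETING PAIRWISE TRANSVERSALLY ("3- If all components of dimension one of `Σ(i)` are regular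
and intersect transversally …"; "the strict transform of `Σ` in `X′` is transverse to the exceptional
divisor, hence to `Γ′` if all components of `Γ` meet transversally"). The companion file
`StrictTransformTransverseCurve` (brick T2c) proves that the strict transform `C̃ = cl(π⁻¹(C ∖ Y))` of a
regular curve `C` (reduced ideal generated pointwise by a PAIR of regular parameters) transverse to the
regular centre `Y` at threefold points is again such a curve, transverse to the exceptional divisor. This
file supplies the GLUE that the pairwise transversality of TWO curves persists (glue (g1)/(g1′) of the F-71
reach decomposition, cell res-hironaka):

* the local algebra is `StrictTransformGenericPoint`'s `sup_stalkIdeal_vanishingIdeal_eq_maximalIdeal_of_surjective`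
  (for ANY morphism `f : X′ → X`: `𝓘_{D₁,x} + 𝓘_{D₂,x} = 𝔪_x`, `Dᵢ′ ⊆ f⁻¹Dᵢ` closed through `c′`, `𝒪_{X,x} → 𝒪_{X′,c′}/𝓘_{D₁′,c′}`
  onto ⇒ `𝓘_{D₁′,c′} + 𝓘_{D₂′,c′} = 𝔪_{c′}`), imported, not restated;
* `stalkIdeal_strictTransform_sup_eq_maximalIdeal_of_transverse` — **for `C` as in T2c, ANY closed
  `D ⊆ X` and any closed `D′ ⊆ π⁻¹(D)` (e.g. the strict or the total transform of `D`, or the reduced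
  exceptional divisor when `D = Y`): at every point `c′ ∈ C̃ ∩ D′`, if `𝓘_{C,π c′} + 𝓘_{D,π c′} = 𝔪_{π c′}`
  then `𝓘_{C̃,c′} + 𝓘_{D′,c′} = 𝔪_{c′}`** — because `𝒪_{X,π c′} → 𝒪_{X′,c′}/𝓘_{C̃,c′}` is onto (`C̃ ≅ C`,
  T2c's `exists_sub_stalkMap_mem_stalkIdeal_strictTransformIdeal_of_transverse`) and `𝓘_C 𝒪_{X′} ⊆ 𝓘_{C̃}`,
  `𝓘_D 𝒪_{X′} ⊆ 𝓘_{D′}` — the argument of T2c clause 2 with `Y` replaced by `D`, i.e. the abstract lemma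
  instantiated with T2c's surjection;
* `stalkIdeal_strictTransform_sup_stalkIdeal_strictTransform_eq_maximalIdeal` — the case `D′ = D̃`: **two
  strict transforms that meet over a point where `C` and `D` are transverse are transverse there**;
* `not_mem_support_strictTransformIdeal_of_transverse_point`,
  `not_mem_closure_preimage_diff_of_transverse_point` — **point centre: if `𝓘_{1,x} + 𝓘_{2,x} = 𝔪_x` for two
  ideal sheaves (closed subsets) through the closed point `x`, their strict transforms under the blowing up
  of `x` are DISJOINT over `x`** (Stacks 0BI7 (3): the intersection multiplicity drops, `1 ↦ 0`; proved
  here directly and in general — no regularity — from `π^*𝓘ᵢ = 𝓘_E · (π^*𝓘ᵢ : 𝓘_E) ⊆ 𝓘_E · 𝓘ᵢ^σ`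
  (`pow_mul_colon_eq_of_le_of_isEffectiveCartier`), which at a common point `c′` over `x` gives
  `𝓘_{E,c′} = 𝔪_x 𝒪_{X′,c′} ⊆ 𝓘_{E,c′} · 𝔪_{c′}`, so `𝓘_{E,c′} = 0` by Nakayama — absurd for an effective
  Cartier divisor).

No definitions, no named facts; `CossartPiltant2008_prop44` itself is NOT proved here.

## Sources

* V. Cossart, O. Piltant, J. Algebra 320 (2008) 1051–1082, proof of Prop. 4.4, p. 10 (steps 1–3 and the
  transversality remark). [CossartPiltant2008]
* The Stacks Project, Tag 0BI7 (Lemma 54.15.3 (3)), Tag 080E, Tag 00DV (Nakayama). [StacksProject]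
* U. Görtz, T. Wedhorn, *Algebraic Geometry I*, 2nd ed. (2020), (13.19) p. 414 (strict transform). [GortzWedhorn2020]
-/

noncomputable section

open CategoryTheory CategoryTheory.Limits AlgebraicGeometry TopologicalSpace IsLocalRing

namespace Literature.AlgebraicGeometry.Resolution

universe u

open Scheme.IdealSheafData

variable {X X' : Scheme.{u}}

/-! ## Strict transforms of a transverse regular curve and of anything else -/

section StrictTransform

variable [IsLocallyNoetherian X] [IsLocallyNoetherian X'] {π : X' ⟶ X} {Y C : Closeds X}
  (hπ : IsBlowup π (vanishingIdeal Y))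
  (hCreg : ∀ x ∈ (C : Set X), ∃ c : Fin 2 → X.presheaf.stalk x,
    IsRsopPart c ∧ Ideal.span (Set.range c) = stalkIdeal (vanishingIdeal C) x)
  (htr : ∀ x ∈ (C : Set X) ∩ Y,
    stalkIdeal (vanishingIdeal C) x ⊔ stalkIdeal (vanishingIdeal Y) x = maximalIdeal _)
  (hdim : ∀ x ∈ (C : Set X) ∩ Y, ringKrullDim (X.presheaf.stalk x) = 3)

include hπ hCreg htr hdim

/-- **Transversality to `C` persists on the strict transform of `C`.** In the setting of T2c (`π` the blowing
up of the locally Noetherian `X` along the reduced closed `Y`; `C ⊆ X` closed with reduced ideal generated at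
each of its points by a pair of regular parameters, transverse to `Y` at the threefold points of `C ∩ Y`), let
`D ⊆ X` be ANY closed subset and `D′ ⊆ X′` any closed subset lying over `D` (`D′ ⊆ π⁻¹(D)`). Then at every
point `c′` of `C̃ ∩ D′`, `C̃ = cl(π⁻¹(C ∖ Y))`, at whose image `C` and `D` are transverse
(`𝓘_{C,π c′} + 𝓘_{D,π c′} = 𝔪_{π c′}`), the strict transform `C̃` and `D′` are transverse:
`𝓘_{C̃,c′} + 𝓘_{D′,c′} = 𝔪_{c′}` (reduced ideals). Proof: `𝒪_{X,π c′} → 𝒪_{X′,c′}/𝓘_{C̃,c′}` is onto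
(T2c: `C̃ ≅ C` over `X`, `exists_sub_stalkMap_mem_stalkIdeal_strictTransformIdeal_of_transverse`), so the
abstract persistence lemma `sup_stalkIdeal_vanishingIdeal_eq_maximalIdeal_of_surjective` applies with
`D₁′ = C̃ ⊆ π⁻¹C`, `D₂′ = D′ ⊆ π⁻¹D`. [cite: CossartPiltant2008, Prop. 4.4 (proof, p. 10)] -/
theorem stalkIdeal_strictTransform_sup_eq_maximalIdeal_of_transverse
    (D : Closeds X) (D' : Closeds X') (hD' : (D' : Set X') ⊆ π ⁻¹' (D : Set X))
    {c' : X'} (hc' : c' ∈ closure (π ⁻¹' ((C : Set X) \ Y))) (hc'D : c' ∈ (D' : Set X'))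
    (hCD : stalkIdeal (vanishingIdeal C) (π c') ⊔ stalkIdeal (vanishingIdeal D) (π c') = maximalIdeal _) :
    stalkIdeal (vanishingIdeal
        (⟨closure (π ⁻¹' ((C : Set X) \ Y)), isClosed_closure⟩ : Closeds X')) c' ⊔
      stalkIdeal (vanishingIdeal D') c' = maximalIdeal _ := by
  -- `C̃ ⊆ π⁻¹ C`
  have hC' : ((⟨closure (π ⁻¹' ((C : Set X) \ Y)), isClosed_closure⟩ : Closeds X') : Set X') ⊆
      π ⁻¹' (C : Set X) :=
    closure_minimal (Set.preimage_mono fun _ h => h.1) (C.isClosed.preimage π.continuous)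
  refine sup_stalkIdeal_vanishingIdeal_eq_maximalIdeal_of_surjective π hC' hD' hc' hc'D ?_ hCD
  -- `𝒪_{X,π c'} → 𝒪_{X',c'}/𝓘_{C̃,c'}` is onto (T2c: `C̃ ≅ C` over `X`)
  obtain ⟨hIeq, -⟩ := vanishingIdeal_closure_eq_strictTransformIdeal_of_transverse hπ hCreg htr hdim
  rw [hIeq]
  have hc'supp : c' ∈ (strictTransformIdeal π (vanishingIdeal Y) (vanishingIdeal C)).support := by
    rw [← SetLike.mem_coe, support_strictTransformIdeal_eq_closure, coe_support_vanishingIdeal,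
      coe_support_vanishingIdeal]
    exact hc'
  obtain ⟨v', hv'⟩ :
      c' ∈ Set.range (strictTransformIdeal π (vanishingIdeal Y) (vanishingIdeal C)).subschemeι := by
    rw [range_subschemeι]
    exact hc'supp
  subst hv'
  exact fun y =>
    exists_sub_stalkMap_mem_stalkIdeal_strictTransformIdeal_of_transverse hπ hCreg htr hdim v' y

/-- **Two strict transforms meeting over a transverse intersection point are transverse** ([CoP1] p. 10, the
pairwise transversality of the curves of `Σ` along the algorithm): for `C` as in T2c and ANY closed `D ⊆ X`,
at every common point `c′` of `C̃ = cl(π⁻¹(C ∖ Y))` and `D̃ = cl(π⁻¹(D ∖ Y))` with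
`𝓘_{C,π c′} + 𝓘_{D,π c′} = 𝔪_{π c′}` one has `𝓘_{C̃,c′} + 𝓘_{D̃,c′} = 𝔪_{c′}`.
[cite: CossartPiltant2008, Prop. 4.4 (proof, p. 10)] -/
theorem stalkIdeal_strictTransform_sup_stalkIdeal_strictTransform_eq_maximalIdeal
    (D : Closeds X) {c' : X'} (hc' : c' ∈ closure (π ⁻¹' ((C : Set X) \ Y)))
    (hc'D : c' ∈ closure (π ⁻¹' ((D : Set X) \ Y)))
    (hCD : stalkIdeal (vanishingIdeal C) (π c') ⊔ stalkIdeal (vanishingIdeal D) (π c') = maximalIdeal _) :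
    stalkIdeal (vanishingIdeal
        (⟨closure (π ⁻¹' ((C : Set X) \ Y)), isClosed_closure⟩ : Closeds X')) c' ⊔
      stalkIdeal (vanishingIdeal
        (⟨closure (π ⁻¹' ((D : Set X) \ Y)), isClosed_closure⟩ : Closeds X')) c' = maximalIdeal _ :=
  stalkIdeal_strictTransform_sup_eq_maximalIdeal_of_transverse hπ hCreg htr hdim D
    ⟨closure (π ⁻¹' ((D : Set X) \ Y)), isClosed_closure⟩
    (closure_minimal (Set.preimage_mono fun _ h => h.1) (D.isClosed.preimage π.continuous)) hc' hc'D hCD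

end StrictTransform

/-! ## Point centre: transverse branches are separated (Stacks 0BI7 (3), `1 ↦ 0`) -/

/-- **Under the blowing up of a closed point `x`, the strict transforms of two ideal sheaves transverse at
`x` are disjoint over `x`** (Stacks 0BI7 (3): the intersection multiplicity drops strictly, here from `1`
to `0`). For `π : X′ → X` the blowing up of the locally Noetherian `X` along the reduced point `x`, ideal
sheaves `𝓘₁, 𝓘₂ ⊆ 𝓘_{x}` with `𝓘_{1,x} + 𝓘_{2,x} = 𝔪_x`, and `c′` over `x` in the support of the strict
transform `𝓘₁^σ = ⋃ₙ (π^*𝓘₁ : 𝓘_Eⁿ)`: `c′ ∉ supp 𝓘₂^σ`. Proof: `π^*𝓘ᵢ = 𝓘_E · (π^*𝓘ᵢ : 𝓘_E) ⊆ 𝓘_E · 𝓘ᵢ^σ`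
(`𝓘_E = π^*𝓘_{x}` an effective Cartier divisor), so at a common point `c′`,
`𝓘_{E,c′} = 𝔪_x 𝒪_{X′,c′} = 𝓘_{1,x} 𝒪 + 𝓘_{2,x} 𝒪 ⊆ 𝓘_{E,c′} (𝓘^σ_{1,c′} + 𝓘^σ_{2,c′}) ⊆ 𝓘_{E,c′} 𝔪_{c′}`, whence
`𝓘_{E,c′} = 0` (Nakayama) — impossible, `𝓘_{E,c′}` being generated by a nonzerodivisor.
[cite: StacksProject, Tag 0BI7 (Lemma 54.15.3 (3))] -/
theorem not_mem_support_strictTransformIdeal_of_transverse_point [IsLocallyNoetherian X]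
    {π : X' ⟶ X} {x : X} (hx : IsClosed ({x} : Set X))
    (hπ : IsBlowup π (vanishingIdeal ⟨{x}, hx⟩)) {J₁ J₂ : X.IdealSheafData}
    (h₁ : J₁ ≤ vanishingIdeal ⟨{x}, hx⟩) (h₂ : J₂ ≤ vanishingIdeal ⟨{x}, hx⟩)
    (htr : stalkIdeal J₁ x ⊔ stalkIdeal J₂ x = maximalIdeal _)
    {c' : X'} (hc'x : π c' = x)
    (hc'₁ : c' ∈ (strictTransformIdeal π (vanishingIdeal ⟨{x}, hx⟩) J₁).support) :
    c' ∉ (strictTransformIdeal π (vanishingIdeal ⟨{x}, hx⟩) J₂).support := by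
  intro hc'₂
  subst hc'x
  set P := vanishingIdeal (⟨{π c'}, hx⟩ : Closeds X) with hP
  -- `π^*J ⊆ 𝓘_E · J^σ` for `J ⊆ 𝓘_{x}`
  have key : ∀ {J : X.IdealSheafData}, J ≤ P → J.comap π ≤ P.comap π * strictTransformIdeal π P J := by
    intro J hJ
    have hle : J.comap π ≤ P.comap π ^ 1 := by rw [pow_one]; exact comap_mono _ hJ
    have hct := controlledTransform_le_strictTransformIdeal π P J 1
    rw [controlledTransform] at hct
    calc J.comap π = P.comap π ^ 1 * colon (J.comap π) (P.comap π ^ 1) :=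
        (pow_mul_colon_eq_of_le_of_isEffectiveCartier hπ.isEffectiveCartier hle).symm
      _ ≤ P.comap π ^ 1 * strictTransformIdeal π P J := mul_le_mul' le_rfl hct
      _ = P.comap π * strictTransformIdeal π P J := by rw [pow_one]
  -- the stalk `𝔱 = 𝓘_{E,c'} = 𝔪_x 𝒪_{X',c'}`
  set 𝔱 := stalkIdeal (P.comap π) c' with h𝔱
  have h𝔱eq : 𝔱 = (maximalIdeal _).map (π.stalkMap c').hom := by
    rw [h𝔱, stalkIdeal_comap_eq_map_stalkMap, hP, stalkIdeal_vanishingIdeal_singleton]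
  -- `𝔱 ⊆ 𝔱 · (J₁^σ + J₂^σ) ⊆ 𝔪 · 𝔱`
  have hσ₁ : stalkIdeal (strictTransformIdeal π P J₁) c' ≤ maximalIdeal _ :=
    (mem_support_iff_stalkIdeal_le _ _).mp hc'₁
  have hσ₂ : stalkIdeal (strictTransformIdeal π P J₂) c' ≤ maximalIdeal _ :=
    (mem_support_iff_stalkIdeal_le _ _).mp hc'₂
  have hincl : 𝔱 ≤ maximalIdeal (X'.presheaf.stalk c') • 𝔱 := by
    rw [Ideal.smul_eq_mul, mul_comm]
    calc 𝔱 = (stalkIdeal J₁ (π c')).map (π.stalkMap c').hom ⊔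
          (stalkIdeal J₂ (π c')).map (π.stalkMap c').hom := by rw [h𝔱eq, ← Ideal.map_sup, htr]
      _ = stalkIdeal (J₁.comap π) c' ⊔ stalkIdeal (J₂.comap π) c' := by
          rw [stalkIdeal_comap_eq_map_stalkMap, stalkIdeal_comap_eq_map_stalkMap]
      _ ≤ stalkIdeal (P.comap π * strictTransformIdeal π P J₁) c' ⊔
          stalkIdeal (P.comap π * strictTransformIdeal π P J₂) c' :=
          sup_le_sup (stalkIdeal_mono (key h₁) _) (stalkIdeal_mono (key h₂) _)
      _ = 𝔱 * (stalkIdeal (strictTransformIdeal π P J₁) c' ⊔ stalkIdeal (strictTransformIdeal π P J₂) c') := by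
          rw [stalkIdeal_mul, stalkIdeal_mul, ← h𝔱, Ideal.mul_sup]
      _ ≤ 𝔱 * maximalIdeal (X'.presheaf.stalk c') := Ideal.mul_mono_right (sup_le hσ₁ hσ₂)
  -- Nakayama: `𝔱 = 0`
  have hfg : 𝔱.FG := by
    rw [h𝔱eq]
    exact Ideal.FG.map (IsNoetherian.noetherian (maximalIdeal (X.presheaf.stalk (π c')))) _
  have h𝔱0 : 𝔱 = ⊥ :=
    Submodule.eq_bot_of_le_smul_of_le_jacobson_bot (maximalIdeal (X'.presheaf.stalk c')) 𝔱 hfg hincl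
      (IsLocalRing.maximalIdeal_le_jacobson ⊥)
  -- but `𝔱` is generated by a nonzerodivisor of the (non-trivial) local ring `𝒪_{X',c'}`
  obtain ⟨t, ht, h𝔱t⟩ := hπ.isEffectiveCartier.exists_stalkIdeal_eq_span c'
  have ht0 : t = 0 := by
    rw [← Ideal.span_singleton_eq_bot, ← h𝔱t]
    exact h𝔱0
  exact (nonZeroDivisors.ne_zero ht) ht0

/-- **Closed-subset form**: under the blowing up `π : X′ → X` of the locally Noetherian `X` along a closed
point `x` (reduced), two closed subsets `C, D` transverse at `x` (`𝓘_{C,x} + 𝓘_{D,x} = 𝔪_x`, reduced ideals)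
have strict transforms `cl(π⁻¹(C ∖ {x}))`, `cl(π⁻¹(D ∖ {x}))` that do NOT meet over `x`.
[cite: StacksProject, Tag 0BI7 (Lemma 54.15.3 (3))] [cite: CossartPiltant2008, Prop. 4.4 (proof, p. 10)] -/
theorem not_mem_closure_preimage_diff_of_transverse_point [IsLocallyNoetherian X] [IsLocallyNoetherian X']
    {π : X' ⟶ X} {x : X} (hx : IsClosed ({x} : Set X))
    (hπ : IsBlowup π (vanishingIdeal ⟨{x}, hx⟩)) {C D : Closeds X}
    (htr : stalkIdeal (vanishingIdeal C) x ⊔ stalkIdeal (vanishingIdeal D) x = maximalIdeal _)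
    {c' : X'} (hc'x : π c' = x) (hc'C : c' ∈ closure (π ⁻¹' ((C : Set X) \ {x}))) :
    c' ∉ closure (π ⁻¹' ((D : Set X) \ {x})) := by
  intro hc'D
  -- `x ∈ C` and `x ∈ D`
  have hxC : x ∈ (C : Set X) := by
    rw [← hc'x]
    exact closure_minimal (Set.preimage_mono fun _ h => h.1) (C.isClosed.preimage π.continuous) hc'C
  have hxD : x ∈ (D : Set X) := by
    rw [← hc'x]
    exact closure_minimal (Set.preimage_mono fun _ h => h.1) (D.isClosed.preimage π.continuous) hc'D
  have hle : ∀ {Z : Closeds X}, x ∈ (Z : Set X) → vanishingIdeal Z ≤ vanishingIdeal ⟨{x}, hx⟩ :=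
    fun hxZ => vanishingIdeal_antimono (fun _ h => by rw [Set.mem_singleton_iff.mp h]; exact hxZ)
  have hsupp : ∀ {Z : Closeds X}, c' ∈ closure (π ⁻¹' ((Z : Set X) \ {x})) →
      c' ∈ (strictTransformIdeal π (vanishingIdeal ⟨{x}, hx⟩) (vanishingIdeal Z)).support := by
    intro Z hZ
    rw [← SetLike.mem_coe, support_strictTransformIdeal_eq_closure, coe_support_vanishingIdeal,
      coe_support_vanishingIdeal]
    exact hZ
  exact not_mem_support_strictTransformIdeal_of_transverse_point hx hπ (hle hxC) (hle hxD) htr hc'x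
    (hsupp hc'C) (hsupp hc'D)

end Literature.AlgebraicGeometry.Resolution

end
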